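import Summits.Schanuel.Schanuel.Theorems.RootDecomp1BProductCell07

/-!
# RootDecomp1BProductCell — lens 4, generation 46 «PRODUCT CELL: TWO INDEPENDENT LIOUVILLE COORDINATES VIA THE QUANTITATIVE STOREY-ONE CELL» (CLAIM L2339, PRICE + CHECKLIST B-g46 L2340, NODE L2399 / REQUEST L2400, critic VERDICT L2407: CLEARED — THEOREM ×1 (K1 twoRadical_lower, the composable quantitative engine) + ONE CELL «RATE-MATCHED PRODUCT 𝒜_W × ℬ_W» (K2 algebraicIndependent_product + cells); RULE B-R33; PORT GO) — continuation (RootDecomp1BProductCell08): §8 the closed-form transcendence measure for θ_σ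

(lens-4 g46 HOME kernel K = HOME/decomp-schanuel-lens-4/g46/ProductCell.lean d6cd9943…, 1931 l, ONE import …RootDecomp1BTwoRadical05; P/C + NODE-g46.md 601195d2…. Port by census-1 gen 20 as `RootDecomp1BProductCell01–08` from the census CAP EDITION ProductCell.capped.lean (K2 `algebraicIndependent_product` is ONE 398-line declaration block > the 400-line file cap: its step (3) «thrP(N) ≤ exp(c_T q⁴)» — four exponential bounds, context-free — is extracted as the public lemma `thr_le_exp_quartic` in §3c with the local abbreviations passed as variables and the defining equation of c_T as a hypothesis; K2's STATEMENT byte-identical, all 87 K decl signatures identical, +1 decl; farm rc 0 · 0/0/0 · axioms std on K2): 01 = §1 Lipschitz (`FrelC`, `lam`, `lipschitz_Frel₂_explicit`) + §2 root avoidance (`fibreSum_ne_zero`); 02 = §3 K1 `thr`, `bigTheta`, `thrP`, **`twoRadical_lower`**; 03 = §3b outer upper half (`norm_normForm_le`, `normForm_len_le`); 04 = §3c `thr_le`, `thr_le_exp_quartic` (cap lemma) + §4 classes `UltraLiouvilleSW` / `TowerLiouville` («[class] definition» tags) + `thr_nonneg` + §5 prelude `thetaS`; 05 = §5 K2 **`algebraicIndependent_product`**;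 06 = §6 law `sw`, members `ultraLiouvilleSW_rhoU` (tree rhoU), `gT`/`vT`/`tTerm`/`rhoT`/`tNum`/`tRat`, `towerLiouville_rhoT`; 07 = §7 cells `algebraicIndependent_eight_of_pos`, `eight_le_polarDeg_one_pair`, `six_le_polarDeg_one_pair`, `schanuel_body_one_pair`, `six_le_polarDeg_pair`, `four_le_polarDeg_pair`, `schanuel_body_pair`, named pair (ρ_U, ρ_T) hyp-free; 08 = §8 `E₅`, `thrP_le_exp`, `transcMeasure_thetaS`, `transcMeasure_rhoU`. PORT EDITS (VERDICT L2407 (a)–(d) + the cap edition): linter option dropped; 26 one-line docstrings added; class tags in the census wording; scoped heartbeats kept `… in` (1600000 ×2, 800000 ×1 as in K); per-part private helper copies; statements and proofs otherwise verbatim (no renames). `--supports stmt-Schanuel-24622`; no census credit carried; rung 0 — nothing here proves Schanuel; no ∀-item moves.)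
-/

noncomputable section
open Complex
namespace Summit.Schanuel.Schanuel.Theorems.RootDecomp1BProductCell
open MvPolynomial
open Summit.Schanuel.Schanuel.Theorems.RootDecomp1KHyper (mvlen mvlen_nonneg one_le_mvlen abs_coeff_le_mvlen)
open RootDecomp1BRadicalDescent (resFin DExpMeasure UltraLiouville exists_int_relation norm_mvaeval_le_mvlen
  totalDegree_det_le mvlen_det_le adjugate_bounds)
open RootDecomp1BTwoRadical (sX₃ sX₃_apply eq_of_parts₃ Cf₂ Frel₂ Frel₂_eq_aeval radMat₂ det_radMat₂_ne_zero
  det_eq_eigen_mul₂ eigen_eq_Frel₂ mvlen_radMat₂_le totalDegree_radMat₂_le mvlen_Cf₂_le twoRadical_clash)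
variable {n : ℕ}

/-- `x^k ≤ exp(k·x)` for `x ≥ 0`. -/
private theorem pow_le_exp_mul {x : ℝ} (hx : 0 ≤ x) (k : ℕ) : x ^ k ≤ Real.exp (k * x) := by
  rw [Real.exp_nat_mul]
  exact pow_le_pow_left₀ hx (by linarith [Real.add_one_le_exp x]) k

/-- `a + exp b ≤ exp (a + b)` for `a, b ≥ 0`. -/
private theorem add_exp_le_exp_add {a b : ℝ} (ha : 0 ≤ a) (hb : 0 ≤ b) : a + Real.exp b ≤ Real.exp (a + b) := by
  rw [Real.exp_add]
  have h1 : a + 1 ≤ Real.exp a := Real.add_one_le_exp a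
  have h2 : 1 ≤ Real.exp b := Real.one_le_exp hb
  nlinarith [Real.exp_pos a, Real.exp_pos b]

set_option maxHeartbeats 1600000 in

/-! ## §8 COROLLARY: A CLOSED-FORM TRANSCENDENCE MEASURE FOR `θ_σ = (e^{σy₀}, e^{σy₁}, σ, θ)`, `σ ∈ 𝒜_sw`

`‖P(θ_σ)‖ ≥ exp(−E₅(C·(deg P + mvlen P)))`, `E₅ = exp∘exp∘exp∘exp∘exp`, `C = C(A₀, θ, y₀, y₁, σ)`: K1 evaluated at
the admissible scale `q_σ ∈ [T(P), sw(T(P))]` that `σ ∈ UltraLiouvilleSW sw` guarantees (`sw_pow_le`: the standard law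
is a tower of height three; `thrP_le_exp`: the threshold is simply exponential in `(deg P, mvlen P)`).  CONSISTENCY: this
is far weaker than a `DExpMeasure` shape (doubly exponential in `deg`, linear in `log mvlen`), as it must be — the tree's
`RootDecomp1BTwoStorey03.not_dExpMeasure_cons_of_liouville` forbids a DExp-shaped measure at a Liouville coordinate. -/

section Measure

/-- `E₅ = exp ∘ exp ∘ exp ∘ exp ∘ exp`. -/
def E₅ (x : ℝ) : ℝ := Real.exp (Real.exp (Real.exp (Real.exp (Real.exp x))))

/-- `2^M ≤ e^M`. -/
private theorem two_pow_le_exp (M : ℕ) : ((2 ^ M : ℕ) : ℝ) ≤ Real.exp M := by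
  push_cast
  calc (2 : ℝ) ^ M ≤ (Real.exp 1) ^ M :=
        pow_le_pow_left₀ (by norm_num) (by linarith [Real.add_one_le_exp (1 : ℝ)]) M
    _ = Real.exp M := by rw [← Real.exp_nat_mul, mul_one]

/-- `3^N ≤ e^{2N}`. -/
private theorem three_pow_le_exp (N : ℕ) : ((3 ^ N : ℕ) : ℝ) ≤ Real.exp (2 * N) := by
  push_cast
  calc (3 : ℝ) ^ N ≤ (Real.exp 2) ^ N :=
        pow_le_pow_left₀ (by norm_num) (by linarith [Real.add_one_le_exp (2 : ℝ)]) N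
    _ = Real.exp (2 * N) := by rw [← Real.exp_nat_mul]; ring_nf

/-- `4k ≤ 9^k`. -/
private theorem four_mul_le_nine_pow (k : ℕ) : 4 * k ≤ 9 ^ k := by
  induction k with
  | zero => simp
  | succ k ih =>
    have : 1 ≤ 9 ^ k := Nat.one_le_pow _ _ (by norm_num)
    rw [pow_succ]
    omega

/-- **The standard law is a tower of height three:** `(sw Q)^k ≤ exp(exp(exp(2Q² + 4k + 1)))`. -/
theorem sw_pow_le (Q k : ℕ) :
    ((sw Q : ℕ) : ℝ) ^ k ≤ Real.exp (Real.exp (Real.exp (2 * (Q : ℝ) ^ 2 + 4 * k + 1))) := by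
  have hsw : ((sw Q : ℕ) : ℝ) ^ k ≤ Real.exp ((((4 * 3 ^ (3 ^ (Q * Q))) * k : ℕ) : ℝ)) := by
    have h1 : ((sw Q : ℕ) : ℝ) ≤ Real.exp (((4 * 3 ^ (3 ^ (Q * Q)) : ℕ) : ℝ)) := two_pow_le_exp _
    calc ((sw Q : ℕ) : ℝ) ^ k ≤ (Real.exp (((4 * 3 ^ (3 ^ (Q * Q)) : ℕ) : ℝ))) ^ k :=
          pow_le_pow_left₀ (by positivity) h1 k
      _ = Real.exp ((((4 * 3 ^ (3 ^ (Q * Q))) * k : ℕ) : ℝ)) := by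
          rw [← Real.exp_nat_mul]
          push_cast
          ring_nf
  have h4k : 4 * k ≤ 9 ^ k := four_mul_le_nine_pow k
  have hMk : (4 * 3 ^ (3 ^ (Q * Q))) * k ≤ 3 ^ (3 ^ (Q * Q) + 2 * k) := by
    have e1 : (3 : ℕ) ^ (3 ^ (Q * Q) + 2 * k) = 3 ^ (3 ^ (Q * Q)) * 9 ^ k := by
      rw [pow_add, pow_mul 3 2 k]
      norm_num
    rw [e1]
    calc (4 * 3 ^ (3 ^ (Q * Q))) * k = (4 * k) * 3 ^ 3 ^ (Q * Q) := by ring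
      _ ≤ 9 ^ k * 3 ^ 3 ^ (Q * Q) := Nat.mul_le_mul_right _ h4k
      _ = 3 ^ 3 ^ (Q * Q) * 9 ^ k := by ring
  have hA : (((4 * 3 ^ (3 ^ (Q * Q))) * k : ℕ) : ℝ) ≤ Real.exp (2 * (((3 ^ (Q * Q) : ℕ) : ℝ) + 2 * k)) := by
    have h' : (((4 * 3 ^ (3 ^ (Q * Q))) * k : ℕ) : ℝ) ≤ ((3 ^ (3 ^ (Q * Q) + 2 * k) : ℕ) : ℝ) := by
      exact_mod_cast hMk
    refine h'.trans ((three_pow_le_exp _).trans (le_of_eq ?_))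
    push_cast
    ring
  have hB : ((3 ^ (Q * Q) : ℕ) : ℝ) ≤ Real.exp (2 * (Q : ℝ) ^ 2) := by
    refine (three_pow_le_exp (Q * Q)).trans (le_of_eq ?_)
    push_cast
    ring
  have hC : (((4 * 3 ^ (3 ^ (Q * Q))) * k : ℕ) : ℝ) ≤ Real.exp (Real.exp (2 * (Q : ℝ) ^ 2 + 4 * k + 1)) := by
    refine hA.trans (Real.exp_le_exp.2 ?_)
    have h2 : 2 * Real.exp (2 * (Q : ℝ) ^ 2) ≤ Real.exp (2 * (Q : ℝ) ^ 2 + 1) := by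
      rw [Real.exp_add]
      nlinarith [Real.exp_pos (2 * (Q : ℝ) ^ 2), Real.add_one_le_exp (1 : ℝ)]
    have h3 : 4 * (k : ℝ) + Real.exp (2 * (Q : ℝ) ^ 2 + 1) ≤ Real.exp (4 * (k : ℝ) + (2 * (Q : ℝ) ^ 2 + 1)) :=
      add_exp_le_exp_add (by positivity) (by positivity)
    have h4 : Real.exp (4 * (k : ℝ) + (2 * (Q : ℝ) ^ 2 + 1)) = Real.exp (2 * (Q : ℝ) ^ 2 + 4 * k + 1) := by
      ring_nf
    linarith
  exact hsw.trans (Real.exp_le_exp.2 hC)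

/-- **The threshold is simply exponential:** `T(P) ≤ exp(c₂ + mvlen P + c₃ · deg P)` with
`c₂ = (A₀+19)·Θ·(⌈σ⌉+2) + 2(A₀+1)`, `c₃ = Λ + (A₀+1)(2⌈σ⌉+3)` (`Θ = bigTheta θ`, `Λ = lam Θ y₀ y₁ (|σ|+2)`). -/
theorem thrP_le_exp (A₀ : ℕ) (θ : Fin n → ℂ) (y₀ y₁ : ℂ) (σ : ℝ) {P : MvPolynomial (Fin (n + 3)) ℤ}
    (hP0 : P ≠ 0) :
    thrP A₀ θ y₀ y₁ σ P ≤ Real.exp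
      ((((A₀ : ℝ) + 19) * bigTheta θ * ((((⌈σ⌉₊ + 1 : ℕ) : ℝ)) + 1) + 2 * ((A₀ : ℝ) + 1)) + mvlen P +
        (lam (bigTheta θ) y₀ y₁ (|σ| + 2) + ((A₀ : ℝ) + 1) * (1 + 2 * (((⌈σ⌉₊ + 1 : ℕ) : ℝ)))) * P.totalDegree) := by
  have hΘ1 : 1 ≤ bigTheta θ := one_le_bigTheta θ
  have hΛ1 : 1 ≤ lam (bigTheta θ) y₀ y₁ (|σ| + 2) := one_le_lam hΘ1 y₀ y₁ (by positivity)
  have hL1 : (1 : ℤ) ≤ mvlen P := one_le_mvlen hP0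
  have hL1r : (1 : ℝ) ≤ ((mvlen P : ℤ) : ℝ) := by exact_mod_cast hL1
  unfold thrP
  set Θ : ℝ := bigTheta θ with hΘ
  set Λ : ℝ := lam Θ y₀ y₁ (|σ| + 2) with hΛ
  set B : ℕ := ⌈σ⌉₊ + 1 with hB
  set D : ℕ := P.totalDegree with hD
  refine (thr_le A₀ hΘ1 hΛ1 B D hL1).trans ?_
  have f1 : ((A₀ : ℝ) + 19) * Θ * ((B : ℝ) + 1) ≤ Real.exp (((A₀ : ℝ) + 19) * Θ * ((B : ℝ) + 1)) := by
    linarith [Real.add_one_le_exp (((A₀ : ℝ) + 19) * Θ * ((B : ℝ) + 1))]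
  have f2 : ((mvlen P : ℤ) : ℝ) * Λ ^ D ≤ Real.exp (((mvlen P : ℤ) : ℝ) + Λ * D) := by
    rw [Real.exp_add]
    refine mul_le_mul (by linarith [Real.add_one_le_exp ((mvlen P : ℤ) : ℝ)]) ?_ (by positivity) (by positivity)
    calc Λ ^ D ≤ Real.exp (D * Λ) := pow_le_exp_mul (by linarith) D
      _ = Real.exp (Λ * D) := by ring_nf
  have f3 : (((D + 2 * (B * D) : ℕ) : ℝ) + 2) ^ (A₀ + 1) ≤
      Real.exp (((A₀ : ℝ) + 1) * ((1 + 2 * (B : ℝ)) * D + 2)) := by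
    refine (pow_le_exp_mul (by positivity) (A₀ + 1)).trans (le_of_eq ?_)
    congr 1
    push_cast
    ring
  have hb0 : (0 : ℝ) ≤ ((mvlen P : ℤ) : ℝ) * Λ ^ D := by positivity
  calc ((A₀ : ℝ) + 19) * Θ * ((B : ℝ) + 1) * (((mvlen P : ℤ) : ℝ) * Λ ^ D) *
        (((D + 2 * (B * D) : ℕ) : ℝ) + 2) ^ (A₀ + 1)
      ≤ Real.exp (((A₀ : ℝ) + 19) * Θ * ((B : ℝ) + 1)) * Real.exp (((mvlen P : ℤ) : ℝ) + Λ * D) *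
          Real.exp (((A₀ : ℝ) + 1) * ((1 + 2 * (B : ℝ)) * D + 2)) :=
        mul_le_mul (mul_le_mul f1 f2 hb0 (Real.exp_pos _).le) f3 (by positivity) (by positivity)
    _ = _ := by
        rw [← Real.exp_add, ← Real.exp_add]
        congr 1
        ring

set_option maxHeartbeats 800000 in
/-- **COROLLARY (closed-form transcendence measure).** Let `θ ∈ ℂⁿ` carry a `DExpMeasure` and let two coordinates be
`e^{y₀}, e^{y₁}`; let `σ > 0` be SHORT-WAIT ultra-Liouville for the standard law, `σ ∈ UltraLiouvilleSW sw`.  Then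
there is `C = C(θ, y₀, y₁, σ)` with, for every nonzero `P ∈ ℤ[X₀, …, X_{n+2}]`,
`‖P(e^{σy₀}, e^{σy₁}, σ, θ)‖ ≥ exp(−E₅(C · (deg P + mvlen P)))`.  In particular `θ_σ` is algebraically
independent with an EXPLICIT measure — the first transcendence MEASURE for a tuple containing a Liouville number and
its exponentials in this tree. -/
theorem transcMeasure_thetaS {θ : Fin n → ℂ} (hθ : DExpMeasure θ) {i₀ i₁ : Fin n} (hne : i₀ ≠ i₁) {y₀ y₁ : ℂ}
    (hy₀ : cexp y₀ = θ i₀) (hy₁ : cexp y₁ = θ i₁) {σ : ℝ} (hσ : UltraLiouvilleSW sw σ) (hσ0 : 0 < σ) :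
    ∃ C : ℝ, ∀ P : MvPolynomial (Fin (n + 3)) ℤ, P ≠ 0 →
      Real.exp (-E₅ (C * ((P.totalDegree : ℝ) + mvlen P))) ≤ ‖aeval (thetaS θ y₀ y₁ σ) P‖ := by
  obtain ⟨A₀, hA₀⟩ := hθ
  set mσ : ℕ := 2 * (A₀ + 2) + 1 with hmσ
  obtain ⟨Q₀, hQ₀⟩ := hσ mσ
  obtain ⟨Qσ, hQσ⟩ := exists_nat_gt (1 / σ)
  have hexpQσ : Real.exp (-(Qσ : ℝ)) < σ := by
    have h1 : 1 / σ < Real.exp Qσ := hQσ.trans_le (by linarith [Real.add_one_le_exp (Qσ : ℝ)])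
    rw [Real.exp_neg]
    exact inv_lt_of_inv_lt₀ hσ0 (by rwa [one_div] at h1)
  set c₂ : ℝ := ((A₀ : ℝ) + 19) * bigTheta θ * ((((⌈σ⌉₊ + 1 : ℕ) : ℝ)) + 1) + 2 * ((A₀ : ℝ) + 1) with hc₂
  set c₃ : ℝ := lam (bigTheta θ) y₀ y₁ (|σ| + 2) + ((A₀ : ℝ) + 1) * (1 + 2 * (((⌈σ⌉₊ + 1 : ℕ) : ℝ))) with hc₃
  set k : ℕ := 2 * (A₀ + 2) with hk
  have hΘ1 : 1 ≤ bigTheta θ := one_le_bigTheta θ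
  have hc₂0 : 0 ≤ c₂ := by rw [hc₂]; positivity
  have hc₃0 : 0 ≤ c₃ := by
    have := one_le_lam hΘ1 y₀ y₁ (show (0 : ℝ) ≤ |σ| + 2 by positivity)
    rw [hc₃]; positivity
  set c₄ : ℝ := c₂ + ((Q₀ + Qσ + 1 : ℕ) : ℝ) with hc₄
  have hc₄0 : 0 ≤ c₄ := by rw [hc₄]; positivity
  refine ⟨4 * c₄ + 4 * k + 4 + 2 * c₃, fun P hP0 => ?_⟩
  set D : ℕ := P.totalDegree with hD
  have hL1 : (1 : ℤ) ≤ mvlen P := one_le_mvlen hP0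
  have hL1r : (1 : ℝ) ≤ ((mvlen P : ℤ) : ℝ) := by exact_mod_cast hL1
  -- the admissible scale of σ above the threshold T(P)
  have hthr0 : 0 ≤ thrP A₀ θ y₀ y₁ σ P :=
    thr_nonneg A₀ (zero_le_one.trans hΘ1) (zero_le_one.trans (one_le_lam hΘ1 y₀ y₁ (by positivity))) _ _
      (le_trans zero_le_one hL1)
  set Q : ℕ := Q₀ + Qσ + ⌈thrP A₀ θ y₀ y₁ σ P⌉₊ with hQ
  obtain ⟨rσ, hQden, hdenW, hσne, hσlt⟩ := hQ₀ Q (by omega)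
  have hden : thrP A₀ θ y₀ y₁ σ P ≤ rσ.den :=
    (Nat.le_ceil _).trans (by exact_mod_cast (show ⌈thrP A₀ θ y₀ y₁ σ P⌉₊ ≤ rσ.den by omega))
  have hdσ1 : (1 : ℝ) ≤ rσ.den := by exact_mod_cast rσ.pos
  have hdσQσ : (Qσ : ℝ) ≤ rσ.den := by exact_mod_cast (show Qσ ≤ rσ.den by omega)
  have hσsmall : Real.exp (-Real.exp ((rσ.den : ℝ) ^ mσ)) ≤ Real.exp (-(Qσ : ℝ)) := by
    refine Real.exp_le_exp.2 (neg_le_neg (hdσQσ.trans ?_))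
    have h1 : (rσ.den : ℝ) ≤ (rσ.den : ℝ) ^ mσ := le_self_pow₀ hdσ1 (show mσ ≠ 0 by omega)
    linarith [Real.add_one_le_exp ((rσ.den : ℝ) ^ mσ)]
  have hrσσ : |σ - rσ| < σ := hσlt.trans_le (hσsmall.trans hexpQσ.le)
  have hrσ1 : |σ - rσ| < 1 := hσlt.trans_le (Real.exp_le_one_iff.2 (neg_nonpos.2 (Real.exp_pos _).le))
  have hrate : |σ - rσ| < Real.exp (-Real.exp ((rσ.den : ℝ) ^ (2 * (A₀ + 2)))) := by
    refine hσlt.trans_le (Real.exp_le_exp.2 (neg_le_neg (Real.exp_le_exp.2 ?_)))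
    exact pow_le_pow_right₀ hdσ1 (by omega)
  -- K1 at P and the scale rσ
  have hlow := twoRadical_lower hA₀ hne hy₀ hy₁ hσ0 P hP0 rσ hden hrσσ hrσ1 hrate
  rw [← aeval_thetaS] at hlow
  refine le_trans (Real.exp_le_exp.2 (neg_le_neg ?_)) hlow
  unfold E₅
  refine Real.exp_le_exp.2 ?_
  have h1 : (((rσ.den : ℕ) : ℝ) ^ 2) ^ (A₀ + 2) ≤ ((sw Q : ℕ) : ℝ) ^ k := by
    rw [← pow_mul, hk]
    exact pow_le_pow_left₀ (by positivity) (by exact_mod_cast hdenW) _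
  refine h1.trans ((sw_pow_le Q k).trans (Real.exp_le_exp.2 (Real.exp_le_exp.2 (Real.exp_le_exp.2 ?_))))
  -- the scale is simply exponential in (deg P, mvlen P)
  have hthr : thrP A₀ θ y₀ y₁ σ P ≤ Real.exp (c₂ + mvlen P + c₃ * D) := thrP_le_exp A₀ θ y₀ y₁ σ hP0
  have hQle : (Q : ℝ) ≤ c₄ + Real.exp (c₂ + mvlen P + c₃ * D) := by
    have h2 : (Q : ℝ) = ((Q₀ + Qσ : ℕ) : ℝ) + (⌈thrP A₀ θ y₀ y₁ σ P⌉₊ : ℝ) := by rw [hQ]; push_cast; ring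
    have h3 : (⌈thrP A₀ θ y₀ y₁ σ P⌉₊ : ℝ) ≤ thrP A₀ θ y₀ y₁ σ P + 1 := (Nat.ceil_lt_add_one hthr0).le
    rw [h2, hc₄]
    push_cast
    linarith
  have hQexp : (Q : ℝ) ≤ Real.exp (c₄ + (c₂ + mvlen P + c₃ * D)) :=
    hQle.trans (add_exp_le_exp_add hc₄0 (by positivity))
  have hQsq : (Q : ℝ) ^ 2 ≤ Real.exp (2 * (c₄ + (c₂ + mvlen P + c₃ * D))) := by
    calc (Q : ℝ) ^ 2 ≤ (Real.exp (c₄ + (c₂ + mvlen P + c₃ * D))) ^ 2 := pow_le_pow_left₀ (by positivity) hQexp 2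
      _ = Real.exp (2 * (c₄ + (c₂ + mvlen P + c₃ * D))) := by rw [← Real.exp_nat_mul]; push_cast; ring_nf
  have hE : 2 * Real.exp (2 * (c₄ + (c₂ + mvlen P + c₃ * D))) + (4 * k + 1) ≤
      Real.exp (2 * (c₄ + (c₂ + mvlen P + c₃ * D)) + 4 * k + 2) := by
    have h2 : 2 * Real.exp (2 * (c₄ + (c₂ + mvlen P + c₃ * D))) ≤
        Real.exp (2 * (c₄ + (c₂ + mvlen P + c₃ * D)) + 1) := by
      rw [Real.exp_add]
      nlinarith [Real.exp_pos (2 * (c₄ + (c₂ + mvlen P + c₃ * D))), Real.add_one_le_exp (1 : ℝ)]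
    have h3 : (4 * (k : ℝ) + 1) + Real.exp (2 * (c₄ + (c₂ + mvlen P + c₃ * D)) + 1) ≤
        Real.exp ((4 * (k : ℝ) + 1) + (2 * (c₄ + (c₂ + mvlen P + c₃ * D)) + 1)) :=
      add_exp_le_exp_add (by positivity) (by positivity)
    have h4 : Real.exp ((4 * (k : ℝ) + 1) + (2 * (c₄ + (c₂ + mvlen P + c₃ * D)) + 1)) =
        Real.exp (2 * (c₄ + (c₂ + mvlen P + c₃ * D)) + 4 * k + 2) := by ring_nf
    linarith
  have hkey : 2 * (c₄ + (c₂ + ((mvlen P : ℤ) : ℝ) + c₃ * D)) + 4 * k + 2 ≤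
      (4 * c₄ + 4 * k + 4 + 2 * c₃) * ((P.totalDegree : ℝ) + mvlen P) := by
    rw [← hD]
    have hD0 : (0 : ℝ) ≤ (D : ℝ) := by positivity
    have hk0 : (0 : ℝ) ≤ (k : ℝ) := by positivity
    have hc₂4 : c₂ ≤ c₄ := by rw [hc₄]; linarith [show (0 : ℝ) ≤ ((Q₀ + Qσ + 1 : ℕ) : ℝ) by positivity]
    have e1 := mul_nonneg hc₄0 hD0
    have e2 := mul_nonneg hk0 hD0
    have e3 := mul_nonneg hc₄0 (sub_nonneg.2 hL1r)
    have e4 := mul_nonneg hk0 (sub_nonneg.2 hL1r)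
    have e5 := mul_nonneg hc₃0 (zero_le_one.trans hL1r)
    have e6 := mul_nonneg hc₃0 hD0
    linarith
  refine le_trans ?_ (Real.exp_le_exp.2 hkey)
  linarith [hQsq, hE]

open RootDecomp1BFactDischarge (lwMeasure_holds) in
open RootDecomp1BRadicalDescent (isAlgebraic_base linearIndependent_base dExpMeasure_exp_of_LW rhoU rhoU_pos) in
/-- **HYPOTHESIS-FREE TRANSCENDENCE MEASURE AT THE NAMED POINT** `θ_{ρ_U} = (e^{ρ_U}, e^{iρ_U}, ρ_U, e, e^{i})`:
`‖P(θ_{ρ_U})‖ ≥ exp(−E₅(C·(deg P + mvlen P)))` for every nonzero `P ∈ ℤ[X₀,…,X₄]` (base measure =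
`dExpMeasure_exp_of_LW lwMeasure_holds`, member = `ultraLiouvilleSW_rhoU`; no binder left). -/
theorem transcMeasure_rhoU : ∃ C : ℝ, ∀ P : MvPolynomial (Fin (2 + 3)) ℤ, P ≠ 0 →
    Real.exp (-E₅ (C * ((P.totalDegree : ℝ) + mvlen P))) ≤
      ‖aeval (thetaS (fun i => cexp (![(1 : ℂ), Complex.I] i)) 1 Complex.I rhoU) P‖ := by
  obtain ⟨A₀, hA₀⟩ := dExpMeasure_exp_of_LW lwMeasure_holds isAlgebraic_base linearIndependent_base
  exact transcMeasure_thetaS ⟨A₀, hA₀⟩ (i₀ := 0) (i₁ := 1) (by decide) (by simp) (by simp) ultraLiouvilleSW_rhoU rhoU_pos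

end Measure

end Summit.Schanuel.Schanuel.Theorems.RootDecomp1BProductCell

end
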